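import Summits.HodgeConjecture.HodgeConjecture.Theorems.F0P3cStCharTSTransport          -- ★ p847804 (this seat): organ «TR» `steinbergCompanion_of_model`, `isAdmissible_pi2_of_keysLabels`, `isAdmissible_of_isSupercuspidal`
import Literature.NumberTheory.Rogawski1990.FinExplicitTransferFactorFormTransport          -- ★ p846358: §3 `finExplicitDelta_cmDatumLocalCongr_symm`, §4 `finsum_finExplicitDelta_mul_classOrbitalIntegral_transport`
import Literature.NumberTheory.Rogawski1990.LocalTransferTransportCanonical                -- ★ `transport_isCanonical_isRegularElt` (canonical families transport along `e`)
import Literature.NumberTheory.Automorphic.UnitaryGroupOrbitalMeasureOfLocalQuotient       -- ★ `isMulRightInvariant_map_mulEquiv_of_isMulRightInvariant`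
import Literature.NumberTheory.Automorphic.LocalUnitaryGroupCongrInner                    -- ★ `conjLocal_eq_self_of_formCongr_eq_smul_antidiag` (`σ a = a` from the frame)
import Literature.NumberTheory.Automorphic.GodementHeightFloor                           -- ★ `Godement.det_ne_zero_of_anisotropic`
import Literature.NumberTheory.Automorphic.CMPrincipalSeriesJacquetEvalOne                -- ★ `nonarchimedeanGroup_unitaryGroupOfForm_local` (every test function has a level)
import Literature.NumberTheory.Rogawski1990.CMCharIdentityClauses                        -- ★ the letters' vocabulary: `OneDimAutRepH`, `xiLocalChar`, `KeysCaseTwoLabels`, `Gqs`, `cmDatumLocalCongr`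
import Literature.NumberTheory.Rogawski1990.LocalTransferFundamentalLemma                -- ★ `IsLocSmooth`
import Literature.NumberTheory.Rogawski1990.LocalTransferLinear                           -- ★ `IsDeltaTransferRel.smul_fun` ((4.3.1) is homogeneous)
import Literature.NumberTheory.Rogawski1990.FinExplicitTransferFactorConjRight            -- ★ `finExplicitCollection`, `finExplicitDelta_conj_left_all∕right_all` (the `Δ‴` of record)
import Literature.NumberTheory.Automorphic.OrbitalMeasureCanonical                        -- ★ `OrbitalMeasureFamily.IsCanonical`
import Literature.NumberTheory.Automorphic.UnitaryGroupPrincipalSeriesH                   -- ★ `HLengthTwoLabels`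
import HarnessLib

/-!
# F0 · P3c · line LH6 «StCharTS» — ORGAN «QS»: the closer row `stub_StCharTS` (N-1273S) REDUCED TO THE QUASI-SPLIT, SIGN-FREE,
# PER-PLACE statement (Rogawski's L. 12.7.3 ∕ Cor. 12.7.4 for `U(Φ₃)(L⁺_v)` VERBATIM)

Cell `pub/hodgecm-mathlib`, crux H413 = `stmt-HodgeConjecture-24833` (`--supports` lane, helper), route HCCMUnconditional; seat LH6-p01 (g0), DEFAULT organ
«QS» announced 2026-09-02T02:17Z on F0∕P3b + F0∕P3c.  THEOREMS ONLY, sorry-free, no definition ∕ instance ∕ notation ∕ named fact.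
HONEST LABEL: HC_CM is proved only modulo the 7 printed citations (2 remaining: hLiu418 = stmt-HodgeConjecture-24832, h413 = stmt-HodgeConjecture-24833)
until rung 0 closes; this file is count-neutral glue — nothing printed is asserted, the printed input (N-1273S) is only RE-SITED on the quasi-split model.

THE MATHEMATICS.  The registered row `stub_StCharTS` of `Cruxes/H413/Lines/F0_U3LettersRung1.lean` (ED. 38) ≡ `stub_steinbergCharTransferSigned` of the P3b line
(ED. 18) states Rogawski's Steinberg character transfer [Rogawski1990, §12.7 L. 12.7.3, Cor. 12.7.4 p. 195] for an INNER FORM `G = U(H)(L⁺_v)` at a non-split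
place `v`, through a frame `ᵗ(σT)·H_v·T = a·Φ₃` (`e := cmDatumLocalCongr : U(Φ₃)_v ≃ₜ* U(H)_v`) and WITH THE SIGN `ε_v(H) = χ(a) = [a ∈ z·σz·units]`:
`Tr πSt(f^H) = ε_v(H)·(Tr (π²∘e⁻¹)(f) − Tr πˢ(f))` for `Δ‴_H`-matched test pairs.  Print has the statement ONLY for the quasi-split `U(Φ₃)` and without a sign.
This file proves that the quasi-split, sign-free statement AT EACH PLACE (the hypothesis `hQS` of `stCharTS_of_quasiSplit`, same `H`-side data, Keys labels on
`U(Φ₃)_v`, `Δ‴_{Φ₃}` of record, canonical measures) IMPLIES the row's text for every `H` and every frame: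
* §1 `isLocalDeltaTransfer_iff_of_formCongr` — `(f^H, f)` is `Δ‴_H`-matched iff `(χ(a)·f^H, f ∘ e)` is `Δ‴_{Φ₃}`-matched for the transported orbital measures
  `e⁻¹_* m_G` (★ `finsum_finExplicitDelta_mul_classOrbitalIntegral_transport`: `Δ‴_{Φ₃}(γ_H, e⁻¹γ′) = χ(a)·Δ‴_H(γ_H, γ′)` [Rogawski1990, §4.3 (4.3.2) p. 43;
  §14.4 p. 237], [LanglandsShelstad1987, §4.2]; ★ `stableOrbitalIntegralRel_smul_fun`);
* §2 `stCharTS_of_quasiSplit` — at the row's place `v` instantiate `hQS` with `e⁻¹_* ν_G` (Haar), `e⁻¹_* m_G` (canonical, ★ `transport_isCanonical_isRegularElt`),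
  get the supercuspidal `πs′` on the model; a `Δ‴_H`-matched `(f^H, φ ∘ e⁻¹)` gives a `Δ‴_{Φ₃}`-matched `(f^H, χ(a)·φ)` (§1 + homogeneity ★ `IsDeltaTransferRel.smul_fun`,
  `χ(a)² = 1`), so `Tr πSt(f^H) = χ(a)·(Tr π²(φ) − Tr πs′(φ))` by linearity of admissible characters (★ `Representation.smoothTrace_smul_of_mem`; `π²` admissible ★
  `isAdmissible_pi2_of_keysLabels`, `πs′` admissible ★ `isAdmissible_of_isSupercuspidal`); ★ organ «TR» `steinbergCompanion_of_model` moves it to `U(H)_v`.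
EFFECT for the pay-down skeleton: the (α)∕(β) organs of (N-1273S) may be typed on `U(Φ₃)(L⁺_v)` exactly as print has them; `stub_StCharTS := stCharTS_of_quasiSplit ‹QS›`.

## References
* [Rogawski1990] J. D. Rogawski, *Automorphic Representations of Unitary Groups in Three Variables*, Ann. of Math. Stud. 123 (1990): §12.7 Lemma 12.7.3 & Cor. 12.7.4
  p. 195; §4.3 (4.3.1)–(4.3.2) p. 43; §4.9 p. 55; §14.2 p. 232; §14.4 pp. 234–237.
* [LanglandsShelstad1987] R. P. Langlands, D. Shelstad, *On the definition of transfer factors*, Math. Ann. 278 (1987), §4.2.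
* [GetzHahn2024] J. Getz, H. Hahn, *An Introduction to Automorphic Representations* (2024), §8.5 (8.15) p. 159.
-/

set_option autoImplicit false
-- the mandated namespace has the single-problem summit's repeated segment (`HodgeConjecture.HodgeConjecture`)
set_option linter.dupNamespace false

noncomputable section

open NumberField IsDedekindDomain MeasureTheory MeasureTheory.Measure
open scoped Matrix MatrixGroups
open Literature.NumberTheory.Rogawski1990 Literature.NumberTheory.Automorphic Literature.NumberTheory.Automorphic.UnitaryGroup
open Literature.NumberTheory.GaloisRepresentations

namespace Summit.HodgeConjecture.HodgeConjecture.Cruxes.H413.F0P3cStCharTSOfQuasiSplit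

/-! ## §1 The matched-pair relation across the two forms -/

open scoped Classical in
/-- **`(f^H, f)` is `Δ‴_H`-matched iff `(χ(a)·f^H, f ∘ e)` is `Δ‴_{Φ₃}`-matched for the transported family `e⁻¹_* m_G`** (`e = cmDatumLocalCongr L v T ha h`,
`χ(a) = ±1` the frame's norm class).  For `G`-regular `γ_H`: `Φ^st(γ_H, χ·f^H) = χ·Φ^st(γ_H, f^H)` (★ `stableOrbitalIntegralRel_smul_fun`) and
`Σᶠ_c Δ‴_{Φ₃}(γ_H, out c)·Φ(c, f ∘ e; e⁻¹_* m_G) = χ·Σᶠ_{c′} Δ‴_H(γ_H, out c′)·Φ(c′, f; m_G)` (★ `finsum_finExplicitDelta_mul_classOrbitalIntegral_transport`), and `χ ≠ 0`.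
[cite: Rogawski1990, §4.3 (4.3.1)–(4.3.2) p. 43; §14.4 p. 237] [cite: LanglandsShelstad1987, §4.2] -/
theorem isLocalDeltaTransfer_iff_of_formCongr (L : Type) [Field L] [NumberField L] [IsCMField L] (H : Matrix (Fin 3) (Fin 3) L) (μ : HeckeCharacter L)
    (v : HeightOneSpectrum (𝓞 ↥(maximalRealSubfield L))) (w : PlacesOver L v) (hw : IsCMField.complexConj L • w.1 = w.1)
    (hherm : (H.map (cmConjRingHom L))ᵀ = H) (hdet : H.det ≠ 0)
    (T : GL (Fin 3) (UnitaryGroup.LocalRing L v)) {a : UnitaryGroup.LocalRing L v} (ha : IsUnit a)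
    (haσ : conjLocal L (IsCMField.complexConj L) v a = a)
    (h : formCongr (conjLocal L (IsCMField.complexConj L) v) T (H.map (algebraMap L (UnitaryGroup.LocalRing L v))) =
      a • (Matrix.of fun i j : Fin 3 => if i.val + j.val + 1 = 3 then (1 : L) else 0).map (algebraMap L (UnitaryGroup.LocalRing L v)))
    [MeasurableSpace ((UnitaryGroup.cmDatum L 3 H).Local v)] [BorelSpace ((UnitaryGroup.cmDatum L 3 H).Local v)] [MeasurableSpace ((UnitaryGroup.cmDatum L 3 (Matrix.of fun i j : Fin 3 => if i.val + j.val + 1 = 3 then (1 : L) else 0)).Local v)] [BorelSpace ((UnitaryGroup.cmDatum L 3 (Matrix.of fun i j : Fin 3 => if i.val + j.val + 1 = 3 then (1 : L) else 0)).Local v)]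
    [∀ γ : (UnitaryGroup.cmDatum L 3 H).Local v, MeasurableSpace (((UnitaryGroup.cmDatum L 3 H).Local v) ⧸ Subgroup.centralizer ({γ} : Set ((UnitaryGroup.cmDatum L 3 H).Local v)))] [∀ γ : (UnitaryGroup.cmDatum L 3 H).Local v, BorelSpace (((UnitaryGroup.cmDatum L 3 H).Local v) ⧸ Subgroup.centralizer ({γ} : Set ((UnitaryGroup.cmDatum L 3 H).Local v)))]
    [∀ γ : (UnitaryGroup.cmDatum L 3 (Matrix.of fun i j : Fin 3 => if i.val + j.val + 1 = 3 then (1 : L) else 0)).Local v, MeasurableSpace (((UnitaryGroup.cmDatum L 3 (Matrix.of fun i j : Fin 3 => if i.val + j.val + 1 = 3 then (1 : L) else 0)).Local v) ⧸ Subgroup.centralizer ({γ} : Set ((UnitaryGroup.cmDatum L 3 (Matrix.of fun i j : Fin 3 => if i.val + j.val + 1 = 3 then (1 : L) else 0)).Local v)))] [∀ γ : (UnitaryGroup.cmDatum L 3 (Matrix.of fun i j : Fin 3 => if i.val + j.val + 1 = 3 then (1 : L) else 0)).Local v, BorelSpace (((UnitaryGroup.cmDatum L 3 (Matrix.of fun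 i j : Fin 3 => if i.val + j.val + 1 = 3 then (1 : L) else 0)).Local v) ⧸ Subgroup.centralizer ({γ} : Set ((UnitaryGroup.cmDatum L 3 (Matrix.of fun i j : Fin 3 => if i.val + j.val + 1 = 3 then (1 : L) else 0)).Local v)))]
    [∀ a' : (UnitaryGroup.cmDatum L 2 (Matrix.of fun i j : Fin 2 => if i.val + j.val + 1 = 2 then (1 : L) else 0)).Local v × (UnitaryGroup.cmDatum L 1 (Matrix.of fun i j : Fin 1 => if i.val + j.val + 1 = 1 then (1 : L) else 0)).Local v, MeasurableSpace (((UnitaryGroup.cmDatum L 2 (Matrix.of fun i j : Fin 2 => if i.val + j.val + 1 = 2 then (1 : L) else 0)).Local v × (UnitaryGroup.cmDatum L 1 (Matrix.of fun i j : Fin 1 => if i.val + j.val + 1 = 1 then (1 : L) else 0)).Local v) ⧸ Subgroup.centralizer ({a'} : Set ((UnitaryGroup.cmDatum L 2 (Matrix.of fun i j : Fin 2 => if i.val + j.val + 1 = 2 then (1 : L) else 0)).Local v × (UnitaryGroup.cmDatum L 1 (Matrix.of fun i j : Fin 1 => if i.val + j.val + 1 = 1 then (1 : L) else 0)).Lo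cal v)))]
    (mHv : OrbitalMeasureFamily ((UnitaryGroup.cmDatum L 2 (Matrix.of fun i j : Fin 2 => if i.val + j.val + 1 = 2 then (1 : L) else 0)).Local v × (UnitaryGroup.cmDatum L 1 (Matrix.of fun i j : Fin 1 => if i.val + j.val + 1 = 1 then (1 : L) else 0)).Local v)) (mGv : OrbitalMeasureFamily ((UnitaryGroup.cmDatum L 3 H).Local v))
    (fH : (UnitaryGroup.cmDatum L 2 (Matrix.of fun i j : Fin 2 => if i.val + j.val + 1 = 2 then (1 : L) else 0)).Local v × (UnitaryGroup.cmDatum L 1 (Matrix.of fun i j : Fin 1 => if i.val + j.val + 1 = 1 then (1 : L) else 0)).Local v → ℂ) (f : (UnitaryGroup.cmDatum L 3 H).Local v → ℂ) :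
    IsLocalDeltaTransfer L H v ((finExplicitCollection L H μ (finExplicitDelta_conj_left_all L H μ) (finExplicitDelta_conj_right_all L H μ)) v) mHv mGv fH f ↔
      IsLocalDeltaTransfer L (Matrix.of fun i j : Fin 3 => if i.val + j.val + 1 = 3 then (1 : L) else 0) v ((finExplicitCollection L (Matrix.of fun i j : Fin 3 => if i.val + j.val + 1 = 3 then (1 : L) else 0) μ (finExplicitDelta_conj_left_all L (Matrix.of fun i j : Fin 3 => if i.val + j.val + 1 = 3 then (1 : L) else 0) μ) (finExplicitDelta_conj_right_all L (Matrix.of fun i j : Fin 3 => if i.val + j.val + 1 = 3 then (1 : L) else 0) μ)) v) mHv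
        (mGv.transport (cmDatumLocalCongr L v T ha h).symm.toMulEquiv (cmDatumLocalCongr L v T ha h).symm.continuous (cmDatumLocalCongr L v T ha h).continuous)
        (((if ∃ z : UnitaryGroup.LocalRing L v, IsUnit z ∧ a = z * UnitaryGroup.conjLocal L (IsCMField.complexConj L) v z then (1 : ℤ) else -1 : ℤ) : ℂ) • fH) (f ∘ (cmDatumLocalCongr L v T ha h)) := by
  have hχ0 : ((if ∃ z : UnitaryGroup.LocalRing L v, IsUnit z ∧ a = z * UnitaryGroup.conjLocal L (IsCMField.complexConj L) v z then (1 : ℤ) else -1 : ℤ) : ℂ) ≠ 0 := by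
    split_ifs <;> norm_num
  rw [isLocalDeltaTransfer_iff, isLocalDeltaTransfer_iff]
  refine forall_congr' fun γH => forall_congr' fun hreg => ?_
  rw [stableOrbitalIntegralRel_smul_fun]
  simp only [finExplicitCollection_Δ_eq]
  rw [finsum_finExplicitDelta_mul_classOrbitalIntegral_transport L v H T ha h w hw hherm hdet haσ μ mGv f γH
    (isUnit_eval_finCharpolyTwo_of_isLocalGRegular L v γH hreg)]
  exact (mul_right_injective₀ hχ0).eq_iff.symm

/-! ## §2 The row from the quasi-split, sign-free, per-place statement -/

open scoped Classical in
/-- **ORGAN «QS» — `stub_StCharTS` (N-1273S, the closer row's TEXT with `Places ∕ HLocal ∕ GpLocal` unfolded) FROM ITS QUASI-SPLIT, SIGN-FREE, PER-PLACE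
VERSION.**  Hypothesis `hQS`: for every CM field `L`, unitary `μ` with `μ|_{𝔸_{L⁺}^×} = ω_{L∕L⁺}`, global character `ξ` of `H = U(2) × U(1)`, non-split place `v`,
Haar measures and CANONICAL orbital families on `H_v` and on the MODEL `U(Φ₃)(L⁺_v)` (over binder-supplied Borel structures), `H`-side labels `(π₁, πSt)` with
`Tr π₁ = χ_{ξ_v}` on test functions, Keys labels `(π², πⁿ)` with `πⁿ` not square-integrable: `∃ πˢ` supercuspidal on `U(Φ₃)_v`, `πˢ ≠ πⁿ`, with
`Tr πSt(f^H) = Tr π²(φ) − Tr πˢ(φ)` for all `Δ‴_{Φ₃}`-matched test pairs `(f^H, φ)` — Rogawski's L. 12.7.3 ∕ Cor. 12.7.4 labels on the quasi-split group, NO sign.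
Conclusion: the row for EVERY hermitian anisotropic `H` and every frame `(T, a)`, with the sign `ε_v(H) = χ(a)`.  Proof: §1 + ★ «TR» (module docstring).
[cite: Rogawski1990, §12.7 Lemma 12.7.3 & Cor. 12.7.4 p. 195; §14.4 pp. 234–237; §4.3 (4.3.2) p. 43] [cite: LanglandsShelstad1987, §4.2] -/
theorem stCharTS_of_quasiSplit
    (hQS : ∀ (L : Type) [Field L] [NumberField L] [IsCMField L] (μ : HeckeCharacter L) (ξ : OneDimAutRepH L) (v : HeightOneSpectrum (𝓞 ↥(maximalRealSubfield L))),
      (∀ w : PlacesOver L v, IsCMField.complexConj L • w.1 = w.1) → μ.IsUnitary →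
      (∀ x : Literature.NumberTheory.GaloisRepresentations.ideleGroup ↥(maximalRealSubfield L),
        μ (AdeleRing.ideleBaseChange (↥(maximalRealSubfield L)) L x) = quadraticHeckeCharCM L x) →
      ∀ [MeasurableSpace ((UnitaryGroup.cmDatum L 2 (Matrix.of fun i j : Fin 2 => if i.val + j.val + 1 = 2 then (1 : L) else 0)).Local v × (UnitaryGroup.cmDatum L 1 (Matrix.of fun i j : Fin 1 => if i.val + j.val + 1 = 1 then (1 : L) else 0)).Local v)] [BorelSpace ((UnitaryGroup.cmDatum L 2 (Matrix.of fun i j : Fin 2 => if i.val + j.val + 1 = 2 then (1 : L) else 0)).Local v × (UnitaryGroup.cmDatum L 1 (Matrix.of fun i j : Fin 1 => if i.val + j.val + 1 = 1 then (1 : L) else 0)).Local v)] [MeasurableSpace ((UnitaryGroup.cmDatum L 3 (Matrix.of fun i j : Fin 3 => if i.val + j.val + 1 = 3 then (1 : L) else 0)).Local v)] [BorelSpace ((UnitaryGroup.cmDatum L 3 (Matrix.of fun i j : Fin 3 => if i.val + j.val + 1 = 3 then (1 : L) else 0)).Local v)]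
        (νHv : Measure ((UnitaryGroup.cmDatum L 2 (Matrix.of fun i j : Fin 2 => if i.val + j.val + 1 = 2 then (1 : L) else 0)).Local v × (UnitaryGroup.cmDatum L 1 (Matrix.of fun i j : Fin 1 => if i.val + j.val + 1 = 1 then (1 : L) else 0)).Local v)) (νQv : Measure ((UnitaryGroup.cmDatum L 3 (Matrix.of fun i j : Fin 3 => if i.val + j.val + 1 = 3 then (1 : L) else 0)).Local v))
        [νHv.IsHaarMeasure] [νHv.IsMulRightInvariant] [νQv.IsHaarMeasure] [νQv.IsMulRightInvariant],
      letI : ∀ a : (UnitaryGroup.cmDatum L 2 (Matrix.of fun i j : Fin 2 => if i.val + j.val + 1 = 2 then (1 : L) else 0)).Local v × (UnitaryGroup.cmDatum L 1 (Matrix.of fun i j : Fin 1 => if i.val + j.val + 1 = 1 then (1 : L) else 0)).Local v, MeasurableSpace (((UnitaryGroup.cmDatum L 2 (Matrix.of fun i j : Fin 2 => if i.val + j.val + 1 = 2 then (1 : L) else 0)).Local v × (UnitaryGroup.cmDatum L 1 (Matrix.of fun i j : Fin 1 => if i.val + j.val + 1 = 1 then (1 : L) else 0)).Local v) ⧸ Subgroup.centralizer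 ({a} : Set ((UnitaryGroup.cmDatum L 2 (Matrix.of fun i j : Fin 2 => if i.val + j.val + 1 = 2 then (1 : L) else 0)).Local v × (UnitaryGroup.cmDatum L 1 (Matrix.of fun i j : Fin 1 => if i.val + j.val + 1 = 1 then (1 : L) else 0)).Local v))) := fun _ => borel _
      haveI : ∀ a : (UnitaryGroup.cmDatum L 2 (Matrix.of fun i j : Fin 2 => if i.val + j.val + 1 = 2 then (1 : L) else 0)).Local v × (UnitaryGroup.cmDatum L 1 (Matrix.of fun i j : Fin 1 => if i.val + j.val + 1 = 1 then (1 : L) else 0)).Local v, BorelSpace (((UnitaryGroup.cmDatum L 2 (Matrix.of fun i j : Fin 2 => if i.val + j.val + 1 = 2 then (1 : L) else 0)).Local v × (UnitaryGroup.cmDatum L 1 (Matrix.of fun i j : Fin 1 => if i.val + j.val + 1 = 1 then (1 : L) else 0)).Local v) ⧸ Subgroup.centralizer ({a} : Set ((UnitaryGroup.cmDatum L 2 (Matrix.of fun i j : Fin 2 => if i.val + j.val + 1 = 2 then (1 : L) else 0)).Local v × (UnitaryGroup.cmDatum L 1 (Matrix.of fun i j : Fin 1 => if i.val + j.val + 1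 = 1 then (1 : L) else 0)).Local v))) := fun _ => ⟨rfl⟩
      letI : ∀ γ : (UnitaryGroup.cmDatum L 3 (Matrix.of fun i j : Fin 3 => if i.val + j.val + 1 = 3 then (1 : L) else 0)).Local v, MeasurableSpace (((UnitaryGroup.cmDatum L 3 (Matrix.of fun i j : Fin 3 => if i.val + j.val + 1 = 3 then (1 : L) else 0)).Local v) ⧸ Subgroup.centralizer ({γ} : Set ((UnitaryGroup.cmDatum L 3 (Matrix.of fun i j : Fin 3 => if i.val + j.val + 1 = 3 then (1 : L) else 0)).Local v))) := fun _ => borel _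
      haveI : ∀ γ : (UnitaryGroup.cmDatum L 3 (Matrix.of fun i j : Fin 3 => if i.val + j.val + 1 = 3 then (1 : L) else 0)).Local v, BorelSpace (((UnitaryGroup.cmDatum L 3 (Matrix.of fun i j : Fin 3 => if i.val + j.val + 1 = 3 then (1 : L) else 0)).Local v) ⧸ Subgroup.centralizer ({γ} : Set ((UnitaryGroup.cmDatum L 3 (Matrix.of fun i j : Fin 3 => if i.val + j.val + 1 = 3 then (1 : L) else 0)).Local v))) := fun _ => ⟨rfl⟩
      ∀ (mHv : OrbitalMeasureFamily ((UnitaryGroup.cmDatum L 2 (Matrix.of fun i j : Fin 2 => if i.val + j.val + 1 = 2 then (1 : L) else 0)).Local v × (UnitaryGroup.cmDatum L 1 (Matrix.of fun i j : Fin 1 => if i.val + j.val + 1 = 1 then (1 : L) else 0)).Local v)) (mQv : OrbitalMeasureFamily ((UnitaryGroup.cmDatum L 3 (Matrix.of fun i j : Fin 3 => if i.val + j.val + 1 = 3 then (1 : L) else 0)).Local v)),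
        mHv.IsCanonical (IsLocalGRegular L v) νHv →
        mQv.IsCanonical (fun γ => IsRegularElt (γ.val : GL (Fin 3) (UnitaryGroup.LocalRing L v))) νQv →
      ∀ [MeasurableSpace (Gqs L v ⧸ Subgroup.center (Gqs L v))] [BorelSpace (Gqs L v ⧸ Subgroup.center (Gqs L v))]
        (μZ : Measure (Gqs L v ⧸ Subgroup.center (Gqs L v))) [μZ.IsHaarMeasure],
      ∀ (π₁ πSt : IrrClass ((UnitaryGroup.cmDatum L 2 (Matrix.of fun i j : Fin 2 => if i.val + j.val + 1 = 2 then (1 : L) else 0)).Local v × (UnitaryGroup.cmDatum L 1 (Matrix.of fun i j : Fin 1 => if i.val + j.val + 1 = 1 then (1 : L) else 0)).Local v)),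
        HLengthTwoLabels L v
          (torusCharPair (conjLocal L (IsCMField.complexConj L) v) (cmLocalForm L 2 v) (cmLocalForm_eq_over L 2 v) 0
            ((torusLocalComponent L (IsCMField.complexConj L) v ξ.η).comp
                (quotConj (conjLocal L (IsCMField.complexConj L) v) (conjLocal_conjLocal_cm L v)) *
              halfModulusChar (UnitaryGroup.LocalRing L v))
            (torusLocalComponent L (IsCMField.complexConj L) v ξ.ψ))
          ((torusLocalComponent L (IsCMField.complexConj L) v ξ.ψ).comp (localDet (IsCMField.complexConj L) v (isUnit_antidiagOne_det L 1))) π₁ πSt →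
        (∀ fH : (UnitaryGroup.cmDatum L 2 (Matrix.of fun i j : Fin 2 => if i.val + j.val + 1 = 2 then (1 : L) else 0)).Local v × (UnitaryGroup.cmDatum L 1 (Matrix.of fun i j : Fin 1 => if i.val + j.val + 1 = 1 then (1 : L) else 0)).Local v → ℂ, IsLocSmooth fH → π₁.smoothTrace νHv fH = charDist (ξ.xiLocalChar v) νHv fH) →
      ∀ (π2 πn : IrrClass (Gqs L v)),
        KeysCaseTwoLabels L v (μ.semilocalComponent L v) (torusLocalComponent L (IsCMField.complexConj L) v ξ.η)
          (torusLocalComponent L (IsCMField.complexConj L) v ξ.ψ) π2 πn →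
        ¬ πn.IsSquareIntegrable μZ →
        ∃ πs : IrrClass (Gqs L v), πs.IsSupercuspidal ∧ πs ≠ πn ∧
          ∀ (fH : (UnitaryGroup.cmDatum L 2 (Matrix.of fun i j : Fin 2 => if i.val + j.val + 1 = 2 then (1 : L) else 0)).Local v × (UnitaryGroup.cmDatum L 1 (Matrix.of fun i j : Fin 1 => if i.val + j.val + 1 = 1 then (1 : L) else 0)).Local v → ℂ) (φ : (UnitaryGroup.cmDatum L 3 (Matrix.of fun i j : Fin 3 => if i.val + j.val + 1 = 3 then (1 : L) else 0)).Local v → ℂ), IsLocSmooth fH → IsLocSmooth φ →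
            IsLocalDeltaTransfer L (Matrix.of fun i j : Fin 3 => if i.val + j.val + 1 = 3 then (1 : L) else 0) v ((finExplicitCollection L (Matrix.of fun i j : Fin 3 => if i.val + j.val + 1 = 3 then (1 : L) else 0) μ (finExplicitDelta_conj_left_all L (Matrix.of fun i j : Fin 3 => if i.val + j.val + 1 = 3 then (1 : L) else 0) μ) (finExplicitDelta_conj_right_all L (Matrix.of fun i j : Fin 3 => if i.val + j.val + 1 = 3 then (1 : L) else 0) μ)) v) mHv mQv fH φ →
            πSt.smoothTrace νHv fH = π2.smoothTrace νQv φ - πs.smoothTrace νQv φ) :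
  ∀ (L : Type) [Field L] [NumberField L] [IsCMField L] (H : Matrix (Fin 3) (Fin 3) L) (μ : HeckeCharacter L)
    [∀ v : HeightOneSpectrum (𝓞 ↥(maximalRealSubfield L)), MeasurableSpace ((UnitaryGroup.cmDatum L 2 (Matrix.of fun i j : Fin 2 => if i.val + j.val + 1 = 2 then (1 : L) else 0)).Local v × (UnitaryGroup.cmDatum L 1 (Matrix.of fun i j : Fin 1 => if i.val + j.val + 1 = 1 then (1 : L) else 0)).Local v)] [∀ v : HeightOneSpectrum (𝓞 ↥(maximalRealSubfield L)), BorelSpace ((UnitaryGroup.cmDatum L 2 (Matrix.of fun i j : Fin 2 => if i.val + j.val + 1 = 2 then (1 : L) else 0)).Local v × (UnitaryGroup.cmDatum L 1 (Matrix.of fun i j : Fin 1 => if i.val + j.val + 1 = 1 then (1 : L) else 0)).Local v)]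
    [∀ v : HeightOneSpectrum (𝓞 ↥(maximalRealSubfield L)), MeasurableSpace ((UnitaryGroup.cmDatum L 3 H).Local v)] [∀ v : HeightOneSpectrum (𝓞 ↥(maximalRealSubfield L)), BorelSpace ((UnitaryGroup.cmDatum L 3 H).Local v)]
    (νH : ∀ v : HeightOneSpectrum (𝓞 ↥(maximalRealSubfield L)), Measure ((UnitaryGroup.cmDatum L 2 (Matrix.of fun i j : Fin 2 => if i.val + j.val + 1 = 2 then (1 : L) else 0)).Local v × (UnitaryGroup.cmDatum L 1 (Matrix.of fun i j : Fin 1 => if i.val + j.val + 1 = 1 then (1 : L) else 0)).Local v)) (νG : ∀ v : HeightOneSpectrum (𝓞 ↥(maximalRealSubfield L)), Measure ((UnitaryGroup.cmDatum L 3 H).Local v))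
    [∀ v, (νH v).IsHaarMeasure] [∀ v, (νH v).IsMulRightInvariant] [∀ v, (νG v).IsHaarMeasure] [∀ v, (νG v).IsMulRightInvariant]
    (hμu : μ.IsUnitary)
    (_hμω : ∀ x : Literature.NumberTheory.GaloisRepresentations.ideleGroup ↥(maximalRealSubfield L),
      μ (AdeleRing.ideleBaseChange (↥(maximalRealSubfield L)) L x) = quadraticHeckeCharCM L x)
    (hherm : (H.map (cmConjRingHom L))ᵀ = H)
    (hanis : ∀ x : Fin 3 → L, Literature.AlgebraicGeometry.ShimuraVarieties.hermForm (cmConjRingHom L) H x x = 0 → x = 0),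
    letI : ∀ (v : HeightOneSpectrum (𝓞 ↥(maximalRealSubfield L))) (a : (UnitaryGroup.cmDatum L 2 (Matrix.of fun i j : Fin 2 => if i.val + j.val + 1 = 2 then (1 : L) else 0)).Local v × (UnitaryGroup.cmDatum L 1 (Matrix.of fun i j : Fin 1 => if i.val + j.val + 1 = 1 then (1 : L) else 0)).Local v), MeasurableSpace (((UnitaryGroup.cmDatum L 2 (Matrix.of fun i j : Fin 2 => if i.val + j.val + 1 = 2 then (1 : L) else 0)).Local v × (UnitaryGroup.cmDatum L 1 (Matrix.of fun i j : Fin 1 => if i.val + j.val + 1 = 1 then (1 : L) else 0)).Local v) ⧸ Subgroup.centralizer ({a} : Set ((UnitaryGroup.cmDatum L 2 (Matrix.of fun i j : Fin 2 => if i.val + j.val + 1 = 2 then (1 : L) else 0)).Local v × (UnitaryGroup.cmDatum L 1 (Matrix.of fun i j : Fin 1 => if i.val + j.val + 1 = 1 then (1 : L) else 0)).Local v))) := fun _ _ => borel _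
    haveI : ∀ (v : HeightOneSpectrum (𝓞 ↥(maximalRealSubfield L))) (a : (UnitaryGroup.cmDatum L 2 (Matrix.of fun i j : Fin 2 => if i.val + j.val + 1 = 2 then (1 : L) else 0)).Local v × (UnitaryGroup.cmDatum L 1 (Matrix.of fun i j : Fin 1 => if i.val + j.val + 1 = 1 then (1 : L) else 0)).Local v), BorelSpace (((UnitaryGroup.cmDatum L 2 (Matrix.of fun i j : Fin 2 => if i.val + j.val + 1 = 2 then (1 : L) else 0)).Local v × (UnitaryGroup.cmDatum L 1 (Matrix.of fun i j : Fin 1 => if i.val + j.val + 1 = 1 then (1 : L) else 0)).Local v) ⧸ Subgroup.centralizer ({a} : Set ((UnitaryGroup.cmDatum L 2 (Matrix.of fun i j : Fin 2 => if i.val + j.val + 1 = 2 then (1 : L) else 0)).Local v × (UnitaryGroup.cmDatum L 1 (Matrix.of fun i j : Fin 1 => if i.val + j.val + 1 = 1 then (1 : L) else 0)).Local v))) := fun _ _ => ⟨rfl⟩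
    letI : ∀ (v : HeightOneSpectrum (𝓞 ↥(maximalRealSubfield L))) (γ : (UnitaryGroup.cmDatum L 3 H).Local v), MeasurableSpace (((UnitaryGroup.cmDatum L 3 H).Local v) ⧸ Subgroup.centralizer ({γ} : Set ((UnitaryGroup.cmDatum L 3 H).Local v))) := fun _ _ => borel _
    haveI : ∀ (v : HeightOneSpectrum (𝓞 ↥(maximalRealSubfield L))) (γ : (UnitaryGroup.cmDatum L 3 H).Local v), BorelSpace (((UnitaryGroup.cmDatum L 3 H).Local v) ⧸ Subgroup.centralizer ({γ} : Set ((UnitaryGroup.cmDatum L 3 H).Local v))) := fun _ _ => ⟨rfl⟩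
    ∀ (mH : ∀ v : HeightOneSpectrum (𝓞 ↥(maximalRealSubfield L)), OrbitalMeasureFamily ((UnitaryGroup.cmDatum L 2 (Matrix.of fun i j : Fin 2 => if i.val + j.val + 1 = 2 then (1 : L) else 0)).Local v × (UnitaryGroup.cmDatum L 1 (Matrix.of fun i j : Fin 1 => if i.val + j.val + 1 = 1 then (1 : L) else 0)).Local v)) (mG : ∀ v : HeightOneSpectrum (𝓞 ↥(maximalRealSubfield L)), OrbitalMeasureFamily ((UnitaryGroup.cmDatum L 3 H).Local v)),
      (∀ v : HeightOneSpectrum (𝓞 ↥(maximalRealSubfield L)), (mH v).IsCanonical (IsLocalGRegular L v) (νH v) ∧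
          (mG v).IsCanonical (fun γ => IsRegularElt (γ.val : GL (Fin 3) (UnitaryGroup.LocalRing L v))) (νG v)) →
      ∀ (ξ : OneDimAutRepH L) (v : HeightOneSpectrum (𝓞 ↥(maximalRealSubfield L))), (∀ w : PlacesOver L v, IsCMField.complexConj L • w.1 = w.1) →
      ∀ (T : GL (Fin 3) (UnitaryGroup.LocalRing L v)) (a : UnitaryGroup.LocalRing L v) (ha : IsUnit a)
        (h : formCongr (conjLocal L (IsCMField.complexConj L) v) T (H.map (algebraMap L (UnitaryGroup.LocalRing L v))) =
          a • (Matrix.of fun i j : Fin 3 => if i.val + j.val + 1 = 3 then (1 : L) else 0).map (algebraMap L (UnitaryGroup.LocalRing L v))),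
      ∀ [MeasurableSpace (Gqs L v ⧸ Subgroup.center (Gqs L v))] [BorelSpace (Gqs L v ⧸ Subgroup.center (Gqs L v))]
        (μZ : Measure (Gqs L v ⧸ Subgroup.center (Gqs L v))) [μZ.IsHaarMeasure],
      ∀ (π₁ πSt : IrrClass ((UnitaryGroup.cmDatum L 2 (Matrix.of fun i j : Fin 2 => if i.val + j.val + 1 = 2 then (1 : L) else 0)).Local v × (UnitaryGroup.cmDatum L 1 (Matrix.of fun i j : Fin 1 => if i.val + j.val + 1 = 1 then (1 : L) else 0)).Local v)),
        HLengthTwoLabels L v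
          (torusCharPair (conjLocal L (IsCMField.complexConj L) v) (cmLocalForm L 2 v) (cmLocalForm_eq_over L 2 v) 0
            ((torusLocalComponent L (IsCMField.complexConj L) v ξ.η).comp
                (quotConj (conjLocal L (IsCMField.complexConj L) v) (conjLocal_conjLocal_cm L v)) *
              halfModulusChar (UnitaryGroup.LocalRing L v))
            (torusLocalComponent L (IsCMField.complexConj L) v ξ.ψ))
          ((torusLocalComponent L (IsCMField.complexConj L) v ξ.ψ).comp (localDet (IsCMField.complexConj L) v (isUnit_antidiagOne_det L 1))) π₁ πSt →
        (∀ fH : (UnitaryGroup.cmDatum L 2 (Matrix.of fun i j : Fin 2 => if i.val + j.val + 1 = 2 then (1 : L) else 0)).Local v × (UnitaryGroup.cmDatum L 1 (Matrix.of fun i j : Fin 1 => if i.val + j.val + 1 = 1 then (1 : L) else 0)).Local v → ℂ, IsLocSmooth fH → π₁.smoothTrace (νH v) fH = charDist (ξ.xiLocalChar v) (νH v) fH) →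
      ∀ (π2 πn : IrrClass (Gqs L v)),
        KeysCaseTwoLabels L v (μ.semilocalComponent L v) (torusLocalComponent L (IsCMField.complexConj L) v ξ.η)
          (torusLocalComponent L (IsCMField.complexConj L) v ξ.ψ) π2 πn →
        ¬ πn.IsSquareIntegrable μZ →
        ∃ πs : IrrClass ((UnitaryGroup.cmDatum L 3 H).Local v), πs.IsSupercuspidal ∧ πs ≠ IrrClass.comap (cmDatumLocalCongr L v T ha h).symm πn ∧
          ∀ (fH : (UnitaryGroup.cmDatum L 2 (Matrix.of fun i j : Fin 2 => if i.val + j.val + 1 = 2 then (1 : L) else 0)).Local v × (UnitaryGroup.cmDatum L 1 (Matrix.of fun i j : Fin 1 => if i.val + j.val + 1 = 1 then (1 : L) else 0)).Local v → ℂ) (f : (UnitaryGroup.cmDatum L 3 H).Local v → ℂ), IsLocSmooth fH → IsLocSmooth f →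
            IsLocalDeltaTransfer L H v ((finExplicitCollection L H μ (finExplicitDelta_conj_left_all L H μ) (finExplicitDelta_conj_right_all L H μ)) v) (mH v) (mG v) fH f →
            πSt.smoothTrace (νH v) fH =
              (if ∃ z : UnitaryGroup.LocalRing L v, IsUnit z ∧ a = z * conjLocal L (IsCMField.complexConj L) v z then (1 : ℂ) else -1) *
                ((IrrClass.comap (cmDatumLocalCongr L v T ha h).symm π2).smoothTrace (νG v) f - πs.smoothTrace (νG v) f) := by
  intro L _ _ _ H μ _ _ _ _ νH νG _ _ _ _ hμu hμω hherm hanis mH mG hcan ξ v hns T a ha h _ _ μZ _ π₁ πSt hHL hπ₁ π2 πn hK hL2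
  -- (0) the statement's quotient σ-algebras at `v`, re-installed as local instances
  letI : ∀ a' : (UnitaryGroup.cmDatum L 2 (Matrix.of fun i j : Fin 2 => if i.val + j.val + 1 = 2 then (1 : L) else 0)).Local v × (UnitaryGroup.cmDatum L 1 (Matrix.of fun i j : Fin 1 => if i.val + j.val + 1 = 1 then (1 : L) else 0)).Local v, MeasurableSpace (((UnitaryGroup.cmDatum L 2 (Matrix.of fun i j : Fin 2 => if i.val + j.val + 1 = 2 then (1 : L) else 0)).Local v × (UnitaryGroup.cmDatum L 1 (Matrix.of fun i j : Fin 1 => if i.val + j.val + 1 = 1 then (1 : L) else 0)).Local v) ⧸ Subgroup.centralizer ({a'} : Set ((UnitaryGroup.cmDatum L 2 (Matrix.of fun i j : Fin 2 => if i.val + j.val + 1 = 2 then (1 : L) else 0)).Local v × (UnitaryGroup.cmDatum L 1 (Matrix.of fun i j : Fin 1 => if i.val + j.val + 1 = 1 then (1 : L) else 0)).Local v))) := fun _ => borel _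
  haveI : ∀ a' : (UnitaryGroup.cmDatum L 2 (Matrix.of fun i j : Fin 2 => if i.val + j.val + 1 = 2 then (1 : L) else 0)).Local v × (UnitaryGroup.cmDatum L 1 (Matrix.of fun i j : Fin 1 => if i.val + j.val + 1 = 1 then (1 : L) else 0)).Local v, BorelSpace (((UnitaryGroup.cmDatum L 2 (Matrix.of fun i j : Fin 2 => if i.val + j.val + 1 = 2 then (1 : L) else 0)).Local v × (UnitaryGroup.cmDatum L 1 (Matrix.of fun i j : Fin 1 => if i.val + j.val + 1 = 1 then (1 : L) else 0)).Local v) ⧸ Subgroup.centralizer ({a'} : Set ((UnitaryGroup.cmDatum L 2 (Matrix.of fun i j : Fin 2 => if i.val + j.val + 1 = 2 then (1 : L) else 0)).Local v × (UnitaryGroup.cmDatum L 1 (Matrix.of fun i j : Fin 1 => if i.val + j.val + 1 = 1 then (1 : L) else 0)).Local v))) := fun _ => ⟨rfl⟩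
  letI : ∀ γ : (UnitaryGroup.cmDatum L 3 H).Local v, MeasurableSpace (((UnitaryGroup.cmDatum L 3 H).Local v) ⧸ Subgroup.centralizer ({γ} : Set ((UnitaryGroup.cmDatum L 3 H).Local v))) := fun _ => borel _
  haveI : ∀ γ : (UnitaryGroup.cmDatum L 3 H).Local v, BorelSpace (((UnitaryGroup.cmDatum L 3 H).Local v) ⧸ Subgroup.centralizer ({γ} : Set ((UnitaryGroup.cmDatum L 3 H).Local v))) := fun _ => ⟨rfl⟩
  -- (1) Borel structures on the model `U(Φ₃)_v` (F0P3b-ref2 #14 n3: the row carries none) and the transported Haar measure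
  letI iMQ : MeasurableSpace ((UnitaryGroup.cmDatum L 3 (Matrix.of fun i j : Fin 3 => if i.val + j.val + 1 = 3 then (1 : L) else 0)).Local v) := borel _
  haveI iBQ : BorelSpace ((UnitaryGroup.cmDatum L 3 (Matrix.of fun i j : Fin 3 => if i.val + j.val + 1 = 3 then (1 : L) else 0)).Local v) := ⟨rfl⟩
  letI : ∀ γ : (UnitaryGroup.cmDatum L 3 (Matrix.of fun i j : Fin 3 => if i.val + j.val + 1 = 3 then (1 : L) else 0)).Local v, MeasurableSpace (((UnitaryGroup.cmDatum L 3 (Matrix.of fun i j : Fin 3 => if i.val + j.val + 1 = 3 then (1 : L) else 0)).Local v) ⧸ Subgroup.centralizer ({γ} : Set ((UnitaryGroup.cmDatum L 3 (Matrix.of fun i j : Fin 3 => if i.val + j.val + 1 = 3 then (1 : L) else 0)).Local v))) := fun _ => borel _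
  haveI : ∀ γ : (UnitaryGroup.cmDatum L 3 (Matrix.of fun i j : Fin 3 => if i.val + j.val + 1 = 3 then (1 : L) else 0)).Local v, BorelSpace (((UnitaryGroup.cmDatum L 3 (Matrix.of fun i j : Fin 3 => if i.val + j.val + 1 = 3 then (1 : L) else 0)).Local v) ⧸ Subgroup.centralizer ({γ} : Set ((UnitaryGroup.cmDatum L 3 (Matrix.of fun i j : Fin 3 => if i.val + j.val + 1 = 3 then (1 : L) else 0)).Local v))) := fun _ => ⟨rfl⟩
  haveI : ((νG v).map (cmDatumLocalCongr L v T ha h).symm).IsMulRightInvariant :=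
    Literature.MeasureTheory.Group.isMulRightInvariant_map_mulEquiv_of_isMulRightInvariant (cmDatumLocalCongr L v T ha h).symm.toMulEquiv
      (cmDatumLocalCongr L v T ha h).symm.continuous.measurable (νG v)
  -- (2) frame facts: a place `w ∣ v`, `det H ≠ 0`, `σ a = a`, class preservation along `e`, canonical transport
  obtain ⟨w⟩ : Nonempty (PlacesOver L v) := inferInstance
  have hw : IsCMField.complexConj L • w.1 = w.1 := hns w
  have hdet : H.det ≠ 0 := Godement.det_ne_zero_of_anisotropic L H hanis
  have haσ : conjLocal L (IsCMField.complexConj L) v a = a :=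
    conjLocal_eq_self_of_formCongr_eq_smul_antidiag L (N := 3) (by norm_num) hherm v T h
  have hcl' : ∀ γ : (UnitaryGroup.cmDatum L 3 (Matrix.of fun i j : Fin 3 => if i.val + j.val + 1 = 3 then (1 : L) else 0)).Local v,
      Corresponds (UnitaryGroup.conjLocal L (IsCMField.complexConj L) v) ((UnitaryGroup.adelicForm L 3 H).map (UnitaryGroup.adeleToLocal L v))
        ((UnitaryGroup.adelicForm L 3 (Matrix.of fun i j : Fin 3 => if i.val + j.val + 1 = 3 then (1 : L) else 0)).map (UnitaryGroup.adeleToLocal L v))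
        ((cmDatumLocalCongr L v T ha h) γ) γ :=
    fun γ => corresponds_comm.1 (corresponds_cmDatumLocalCongr L v T ha h γ)
  have hmQ : (((mG v).transport (cmDatumLocalCongr L v T ha h).symm.toMulEquiv (cmDatumLocalCongr L v T ha h).symm.continuous (cmDatumLocalCongr L v T ha h).continuous)).IsCanonical
      (fun γ => IsRegularElt (γ.val : GL (Fin 3) (UnitaryGroup.LocalRing L v))) ((νG v).map (cmDatumLocalCongr L v T ha h).symm) :=
    transport_isCanonical_isRegularElt L H v (cmDatumLocalCongr L v T ha h).symm (fun γ => by simpa only [ContinuousMulEquiv.symm_symm] using hcl' γ)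
      (νG v) ((νG v).map (cmDatumLocalCongr L v T ha h).symm) rfl (hcan v).2
  -- (3) the quasi-split statement at `v` for the transported data
  obtain ⟨πs', hsc, hne, hid⟩ := hQS L μ ξ v hns hμu hμω (νH v) ((νG v).map (cmDatumLocalCongr L v T ha h).symm) (mH v) ((mG v).transport (cmDatumLocalCongr L v T ha h).symm.toMulEquiv (cmDatumLocalCongr L v T ha h).symm.continuous (cmDatumLocalCongr L v T ha h).continuous) (hcan v).1 hmQ μZ π₁ πSt hHL hπ₁ π2 πn hK hL2
  -- (4) the sign and the model-side identity in «TR»'s currency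
  have hχχ : ((if ∃ z : UnitaryGroup.LocalRing L v, IsUnit z ∧ a = z * UnitaryGroup.conjLocal L (IsCMField.complexConj L) v z then (1 : ℤ) else -1 : ℤ) : ℂ) * ((if ∃ z : UnitaryGroup.LocalRing L v, IsUnit z ∧ a = z * UnitaryGroup.conjLocal L (IsCMField.complexConj L) v z then (1 : ℤ) else -1 : ℤ) : ℂ) = 1 := by
    split_ifs <;> norm_num
  have hχsgn : ((if ∃ z : UnitaryGroup.LocalRing L v, IsUnit z ∧ a = z * UnitaryGroup.conjLocal L (IsCMField.complexConj L) v z then (1 : ℤ) else -1 : ℤ) : ℂ) = (if ∃ z : UnitaryGroup.LocalRing L v, IsUnit z ∧ a = z * conjLocal L (IsCMField.complexConj L) v z then (1 : ℂ) else -1) := by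
    split_ifs <;> norm_num
  haveI : NonarchimedeanGroup ((UnitaryGroup.cmDatum L 3 (Matrix.of fun i j : Fin 3 => if i.val + j.val + 1 = 3 then (1 : L) else 0)).Local v) :=
    nonarchimedeanGroup_unitaryGroupOfForm_local (E := L) (c := IsCMField.complexConj L) (N := 3) (v := v)
      (J' := (UnitaryGroup.adelicForm L 3 (Matrix.of fun i j : Fin 3 => if i.val + j.val + 1 = 3 then (1 : L) else 0)).map (UnitaryGroup.adeleToLocal L v))
  have hlin : ∀ (π : IrrClass ((UnitaryGroup.cmDatum L 3 (Matrix.of fun i j : Fin 3 => if i.val + j.val + 1 = 3 then (1 : L) else 0)).Local v)), π.IsAdmissible → ∀ (φ : (UnitaryGroup.cmDatum L 3 (Matrix.of fun i j : Fin 3 => if i.val + j.val + 1 = 3 then (1 : L) else 0)).Local v → ℂ), IsLocSmooth φ →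
      π.smoothTrace ((νG v).map (cmDatumLocalCongr L v T ha h).symm) (((if ∃ z : UnitaryGroup.LocalRing L v, IsUnit z ∧ a = z * UnitaryGroup.conjLocal L (IsCMField.complexConj L) v z then (1 : ℤ) else -1 : ℤ) : ℂ) • φ) = ((if ∃ z : UnitaryGroup.LocalRing L v, IsUnit z ∧ a = z * UnitaryGroup.conjLocal L (IsCMField.complexConj L) v z then (1 : ℤ) else -1 : ℤ) : ℂ) * π.smoothTrace ((νG v).map (cmDatumLocalCongr L v T ha h).symm) φ := by
    intro π hπ φ hφ
    induction π using IrrClass.ind with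
    | h r => exact r.ρ.smoothTrace_smul_of_mem _ ((IrrClass.isAdmissible_mk r).1 hπ) _ ⟨hφ.1, hφ.2⟩
  refine F0P3cStCharTSTransport.steinbergCompanion_of_model (cmDatumLocalCongr L v T ha h) (νG v) (νH v)
    (IsLocalDeltaTransfer L H v ((finExplicitCollection L H μ (finExplicitDelta_conj_left_all L H μ) (finExplicitDelta_conj_right_all L H μ)) v) (mH v) (mG v)) πSt π2 πn (if ∃ z : UnitaryGroup.LocalRing L v, IsUnit z ∧ a = z * conjLocal L (IsCMField.complexConj L) v z then (1 : ℂ) else -1)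
    (F0P3cStCharTSTransport.isAdmissible_pi2_of_keysLabels L μ ξ v hK) ⟨πs', hsc, hne, ?_⟩
  intro fH φ hfH hφ hm
  -- `(f^H, φ ∘ e⁻¹)` `Δ‴_H`-matched ⇒ `(χ·f^H, φ)` `Δ‴_Φ₃`-matched (§1) ⇒ `(f^H, χ·φ)` `Δ‴_Φ₃`-matched (homogeneity, `χ² = 1`)
  have hφe : (φ ∘ (cmDatumLocalCongr L v T ha h).symm) ∘ (cmDatumLocalCongr L v T ha h) = φ := by
    funext q
    simp only [Function.comp_apply, ContinuousMulEquiv.symm_apply_apply]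
  have hm₁ := (isLocalDeltaTransfer_iff_of_formCongr L H μ v w hw hherm hdet T ha haσ h (mH v) (mG v) fH (φ ∘ (cmDatumLocalCongr L v T ha h).symm)).1 hm
  rw [hφe] at hm₁
  have hm₂ : IsLocalDeltaTransfer L (Matrix.of fun i j : Fin 3 => if i.val + j.val + 1 = 3 then (1 : L) else 0) v ((finExplicitCollection L (Matrix.of fun i j : Fin 3 => if i.val + j.val + 1 = 3 then (1 : L) else 0) μ (finExplicitDelta_conj_left_all L (Matrix.of fun i j : Fin 3 => if i.val + j.val + 1 = 3 then (1 : L) else 0) μ) (finExplicitDelta_conj_right_all L (Matrix.of fun i j : Fin 3 => if i.val + j.val + 1 = 3 then (1 : L) else 0) μ)) v) (mH v) ((mG v).transport (cmDatumLocalCongr L v T ha h).symm.toMulEquiv (cmDatumLocalCongr L v T ha h).symm.continuous (cmDatumLocalCongr L v T ha h).continuous) fH (((if ∃ z : UnitaryGroup.LocalRing L v, IsUnit z ∧ a = z * UnitaryGroup.conjLocal L (IsCMField.complexConj L) v z then (1 : ℤ) else -1 : ℤ) : ℂ) • φ) := by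
    have h₂ := IsDeltaTransferRel.smul_fun hm₁ ((if ∃ z : UnitaryGroup.LocalRing L v, IsUnit z ∧ a = z * UnitaryGroup.conjLocal L (IsCMField.complexConj L) v z then (1 : ℤ) else -1 : ℤ) : ℂ)
    rwa [smul_smul, hχχ, one_smul] at h₂
  have hχφ : IsLocSmooth (((if ∃ z : UnitaryGroup.LocalRing L v, IsUnit z ∧ a = z * UnitaryGroup.conjLocal L (IsCMField.complexConj L) v z then (1 : ℤ) else -1 : ℤ) : ℂ) • φ) := ⟨hφ.1.comp fun z => ((if ∃ z : UnitaryGroup.LocalRing L v, IsUnit z ∧ a = z * UnitaryGroup.conjLocal L (IsCMField.complexConj L) v z then (1 : ℤ) else -1 : ℤ) : ℂ) * z, hφ.2.mono (Function.support_const_smul_subset _ φ)⟩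
  rw [hid fH _ hfH hχφ hm₂, hlin π2 (F0P3cStCharTSTransport.isAdmissible_pi2_of_keysLabels L μ ξ v hK) φ hφ,
    hlin πs' (F0P3cStCharTSTransport.isAdmissible_of_isSupercuspidal πs' hsc) φ hφ, ← hχsgn]
  ring

end Summit.HodgeConjecture.HodgeConjecture.Cruxes.H413.F0P3cStCharTSOfQuasiSplit
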